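import Summits.QuantumFields.QCD.Theorems.GaussianLinkFramesFrameFMClosurePlacementCollarAux2

/-!
# Crux `GaussianLinkFrames.FrameFMClosure` (stmt-QuantumFields-17375), line `pad-the-fibre`, stub
`stub_placementCollar` — helper 3: the data of the collar recipe (pad centre, frozen layers, excluded coordinates)

Integer chart about the collar centre (`Ŵ = [-ℓ-1, ℓ]⁴ ⊂ Λ̂ = [-3ℓ-3, 3ℓ+2]⁴`, `ℓ ≥ 1`).  For a point `a ∈ Λ̂ ∖ Ŵ`:
* `collar_data_b` — the PAD CENTRE `b`: `b₀ ∈ {a₀, a₀+1}` with `b₀ ≡ ℓ (mod 2)` (so that the `0`-flips of all pads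
  are aligned: every forced value `±(ℓ+2)`, `±(3ℓ+2)` has the parity of `ℓ`); for `k ≠ 0`, `b_k = a_k + 1` exactly
  when `a_k ∈ {ℓ+1, -3ℓ-3, -3ℓ-2}`, else `b_k = a_k`.  Then `b ∈ [-3ℓ-2, 3ℓ+2]⁴`, some `b_j ∉ [-ℓ-1, ℓ+1]` (escape
  from `Ŵ`), and off coordinate `0` a boundary layer of the pad sticks out of `Λ̂` only where `a` lies ON that face.
* `collar_data_inner` — pads meeting `Ŵ` (`b ∈ [-ℓ-2, ℓ+2]⁴`): ONE frozen layer `M = {j}` (the layer inside `Ŵ`), no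
  excluded coordinate, free coordinate `d₀ = j`; the pad lies inside `Λ̂`.
* `collar_data_outer` — pads missing `Ŵ`: `M = {k : b_k = ±(3ℓ+2)}` (the layers outside `Λ̂`), `E = M ∖ {0}`,
  `d₀ = 0`.
Each produces exactly the hypotheses of helpers 1–2.

References: placement recipe of the line card `pad-the-fibre` (triage r1-1 sharpen 1); elementary [folklore].
-/

noncomputable section

open scoped BigOperators
open Literature.Probability.LatticeModels

namespace Summit.QuantumFields.QCD.Theorems.PadTheFibreCollar

/-- **The pad centre of a collar point.** [folklore] -/
theorem collar_data_b (ℓ : ℕ) (hℓ : 1 ≤ ℓ) (a : Site 4)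
    (haΛ : ∀ i, -(3 * (ℓ : ℤ) + 3) ≤ a i ∧ a i ≤ 3 * ℓ + 2) (haW : ¬ ∀ i, -(ℓ : ℤ) - 1 ≤ a i ∧ a i ≤ ℓ) :
    ∃ b : Site 4, (∀ i, a i - b i = 0 ∨ a i - b i = -1) ∧
      (∀ i, -(3 * (ℓ : ℤ) + 2) ≤ b i ∧ b i ≤ 3 * ℓ + 2) ∧ (b 0 - (ℓ : ℤ)) % 2 = 0 ∧
      (∃ j, b j ≤ -(ℓ : ℤ) - 2 ∨ (ℓ : ℤ) + 2 ≤ b j) ∧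
      (∀ k, k ≠ 0 → b k = 3 * ℓ + 2 → a k = 3 * ℓ + 2) ∧
      (∀ k, k ≠ 0 → b k = -(3 * (ℓ : ℤ) + 2) → a k = -(3 * (ℓ : ℤ) + 3)) := by
  obtain ⟨j, hj⟩ := not_forall.1 haW
  refine ⟨fun i => if i = 0 then (if (a 0 - (ℓ : ℤ)) % 2 = 0 then a 0 else a 0 + 1)
    else (if a i = ℓ + 1 ∨ a i = -(3 * (ℓ : ℤ) + 3) ∨ a i = -(3 * (ℓ : ℤ) + 2) then a i + 1 else a i),
    fun i => ?_, fun i => ?_, ?_, ⟨j, ?_⟩, fun k hk h => ?_, fun k hk h => ?_⟩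
  · by_cases hi : i = 0
    · subst hi; simp only [if_true]; split_ifs <;> omega
    · simp only [hi, if_false]; split_ifs <;> omega
  · have := haΛ i
    by_cases hi : i = 0
    · subst hi; simp only [if_true]; split_ifs <;> omega
    · simp only [hi, if_false]; split_ifs <;> omega
  · simp only [if_true]; split_ifs <;> omega
  · have := haΛ j
    by_cases hj0 : j = 0
    · subst hj0; simp only [if_true]; split_ifs <;> omega
    · simp only [hj0, if_false]; split_ifs <;> omega
  · simp only [hk, if_false] at h; split_ifs at h <;> omega
  · simp only [hk, if_false] at h; split_ifs at h <;> omega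

/-- **Data of an INNER collar pad** (the pad meets `Ŵ`; one frozen layer inside `Ŵ`, nothing excluded): the
hypotheses of helpers 1–2 hold with `M = {j}`, `E = ∅`, `d₀ = j`. [folklore] -/
theorem collar_data_inner (ℓ : ℕ) (hℓ : 1 ≤ ℓ) (a b : Site 4)
    (hin : ∀ i, -(ℓ : ℤ) - 2 ≤ b i ∧ b i ≤ ℓ + 2) (j : Fin 4) (hj : b j ≤ -(ℓ : ℤ) - 2 ∨ (ℓ : ℤ) + 2 ≤ b j) :
    ∃ (c : Site 4) (M E : Finset (Fin 4)) (d₀ : Fin 4),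
      (∀ k ∈ M, c k = -2 ∨ c k = 1) ∧ E ⊆ M ∧ (0 : Fin 4) ∉ E ∧ d₀ ∉ E ∧ (∀ k ∈ M, k ∈ E ∨ k = d₀) ∧
      (∀ k ∈ E, (c k = 1 → a k - b k = 0) ∧ (c k = -2 → a k - b k = -1)) ∧
      (∀ w : Site 4, (∀ i, -2 ≤ w i ∧ w i ≤ 1) → (∀ i, -(ℓ : ℤ) - 1 ≤ b i + w i ∧ b i + w i ≤ ℓ) →
        ∃ k ∈ M, w k = c k) ∧
      (∀ w : Site 4, (∀ i, -2 ≤ w i ∧ w i ≤ 1) → ∀ k : Fin 4,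
        (b k + w k < -(3 * (ℓ : ℤ) + 3) ∨ 3 * (ℓ : ℤ) + 2 < b k + w k) → (k ∈ E ∨ k = 0) ∧ k ∈ M ∧ w k = c k) ∧
      (∀ k ∈ E, (c k = 1 → a k = 3 * ℓ + 2) ∧ (c k = -2 → a k = -(3 * (ℓ : ℤ) + 3))) := by
  refine ⟨fun _ => if b j = ℓ + 2 then -2 else 1, {j}, ∅, j, fun k _ => ?_, Finset.empty_subset _,
    Finset.notMem_empty _, Finset.notMem_empty _, fun k hk => Or.inr (Finset.mem_singleton.1 hk),
    fun k hk => (Finset.notMem_empty k hk).elim, fun w hw hW => ⟨j, Finset.mem_singleton_self j, ?_⟩,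
    fun w hw k hk => ?_, fun k hk => (Finset.notMem_empty k hk).elim⟩
  · dsimp only; split_ifs <;> simp
  · have := hW j; have := hw j; have := hin j
    dsimp only
    split_ifs with h <;> omega
  · exfalso
    have := hw k; have := hin k
    omega

/-- **Data of an OUTER collar pad** (the pad misses `Ŵ`; frozen layers = the layers outside `Λ̂`, all excluded but
the `0`-layer): the hypotheses of helpers 1–2 hold with `M = {k : b_k = ±(3ℓ+2)}`, `E = M ∖ {0}`, `d₀ = 0`. [folklore] -/
theorem collar_data_outer (ℓ : ℕ) (a b : Site 4)
    (hb : ∀ i, -(3 * (ℓ : ℤ) + 2) ≤ b i ∧ b i ≤ 3 * ℓ + 2)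
    (hface : ∀ k, k ≠ 0 → b k = 3 * ℓ + 2 → a k = 3 * ℓ + 2)
    (hface' : ∀ k, k ≠ 0 → b k = -(3 * (ℓ : ℤ) + 2) → a k = -(3 * (ℓ : ℤ) + 3))
    (hout : ∃ k, b k < -(ℓ : ℤ) - 2 ∨ (ℓ : ℤ) + 2 < b k) :
    ∃ (c : Site 4) (M E : Finset (Fin 4)) (d₀ : Fin 4),
      (∀ k ∈ M, c k = -2 ∨ c k = 1) ∧ E ⊆ M ∧ (0 : Fin 4) ∉ E ∧ d₀ ∉ E ∧ (∀ k ∈ M, k ∈ E ∨ k = d₀) ∧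
      (∀ k ∈ E, (c k = 1 → a k - b k = 0) ∧ (c k = -2 → a k - b k = -1)) ∧
      (∀ w : Site 4, (∀ i, -2 ≤ w i ∧ w i ≤ 1) → (∀ i, -(ℓ : ℤ) - 1 ≤ b i + w i ∧ b i + w i ≤ ℓ) →
        ∃ k ∈ M, w k = c k) ∧
      (∀ w : Site 4, (∀ i, -2 ≤ w i ∧ w i ≤ 1) → ∀ k : Fin 4,
        (b k + w k < -(3 * (ℓ : ℤ) + 3) ∨ 3 * (ℓ : ℤ) + 2 < b k + w k) → (k ∈ E ∨ k = 0) ∧ k ∈ M ∧ w k = c k) ∧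
      (∀ k ∈ E, (c k = 1 → a k = 3 * ℓ + 2) ∧ (c k = -2 → a k = -(3 * (ℓ : ℤ) + 3))) := by
  classical
  set M : Finset (Fin 4) := Finset.univ.filter fun k => b k = 3 * ℓ + 2 ∨ b k = -(3 * (ℓ : ℤ) + 2) with hM
  have hmemM : ∀ k, k ∈ M ↔ b k = 3 * ℓ + 2 ∨ b k = -(3 * (ℓ : ℤ) + 2) := fun k => by simp [hM]
  have hmemE : ∀ k, k ∈ M.filter (fun k => k ≠ 0) ↔ (b k = 3 * ℓ + 2 ∨ b k = -(3 * (ℓ : ℤ) + 2)) ∧ k ≠ 0 :=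
    fun k => by simp [hM]
  refine ⟨fun k => if b k = 3 * ℓ + 2 then 1 else -2, M, M.filter fun k => k ≠ 0, 0, fun k _ => ?_,
    Finset.filter_subset _ _, by simp, by simp, fun k hk => ?_, fun k hk => ?_, fun w hw hW => ?_,
    fun w hw k hk => ?_, fun k hk => ?_⟩
  · dsimp only; split_ifs <;> simp
  · by_cases hk0 : k = 0
    · exact Or.inr hk0
    · exact Or.inl (Finset.mem_filter.2 ⟨hk, hk0⟩)
  · obtain ⟨hbk, hk0⟩ := (hmemE k).1 hk
    dsimp only
    constructor
    · intro h
      have hbk' : b k = 3 * ℓ + 2 := by by_contra h'; rw [if_neg h'] at h; norm_num at h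
      have := hface k hk0 hbk'; omega
    · intro h
      have hbk' : ¬ b k = 3 * ℓ + 2 := by intro h'; rw [if_pos h'] at h; norm_num at h
      have := hface' k hk0 (by omega); omega
  · exfalso
    obtain ⟨k, hk⟩ := hout
    have := hW k; have := hw k
    omega
  · have hwk := hw k; have hbk := hb k
    have hkM : b k = 3 * ℓ + 2 ∨ b k = -(3 * (ℓ : ℤ) + 2) := by omega
    refine ⟨?_, (hmemM k).2 hkM, ?_⟩
    · by_cases hk0 : k = 0
      · exact Or.inr hk0
      · exact Or.inl ((hmemE k).2 ⟨hkM, hk0⟩)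
    · dsimp only
      split_ifs with h <;> omega
  · obtain ⟨hbk, hk0⟩ := (hmemE k).1 hk
    dsimp only
    constructor
    · intro h
      have hbk' : b k = 3 * ℓ + 2 := by by_contra h'; rw [if_neg h'] at h; norm_num at h
      exact hface k hk0 hbk'
    · intro h
      have hbk' : ¬ b k = 3 * ℓ + 2 := by intro h'; rw [if_pos h'] at h; norm_num at h
      exact hface' k hk0 (by omega)

/-- **Registered helper `stub_placementCollar_aux3` of crux stmt-QuantumFields-17375** (line `pad-the-fibre`, stub
`stub_placementCollar`): the pad centre of a collar point (integer chart) — one line (`collar_data_b`). [folklore] -/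
theorem stub_placementCollar_aux3 : ∀ (ℓ : ℕ) (_ : 1 ≤ ℓ) (a : Site 4) (_ : ∀ i, -(3 * (ℓ : ℤ) + 3) ≤ a i ∧ a i ≤ 3 * ℓ + 2) (_ : ¬ ∀ i, -(ℓ : ℤ) - 1 ≤ a i ∧ a i ≤ ℓ), ∃ b : Site 4, (∀ i, a i - b i = 0 ∨ a i - b i = -1) ∧ (∀ i, -(3 * (ℓ : ℤ) + 2) ≤ b i ∧ b i ≤ 3 * ℓ + 2) ∧ (b 0 - (ℓ : ℤ)) % 2 = 0 ∧ (∃ j, b j ≤ -(ℓ : ℤ) - 2 ∨ (ℓ : ℤ) + 2 ≤ b j) ∧ (∀ k, k ≠ 0 → b k = 3 * ℓ + 2 → a k = 3 * ℓ + 2) ∧ (∀ k, k ≠ 0 → b k = -(3 * (ℓ : ℤ) + 2) → a k = -(3 * (ℓ : ℤ) + 3)) :=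
  collar_data_b

end Summit.QuantumFields.QCD.Theorems.PadTheFibreCollar

end
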